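import Summits.Langlands.Langlands.Theses.ResidualAvatarLadder

/-!
# Glue of the generation-2 resplit of `ResiduallyLieAutomorphy` (route ResidualAvatarLadder, rev 4)

Closes the glue item `stmt-Langlands-31188` of `route-Langlands-ResidualAvatarLadder`:
`ResiduallyLieAutomorphy_of_split3 : CoreIrreducibleAutomorphy → CoreReducibleOrdinaryAutomorphy →
CoreReducibleNonOrdinaryAutomorphy → ResiduallyLieAutomorphy` (lens-1 node `SlopeLadder`,
decomp-langlands 2026-08-30; the node proof `residuallyLie_of_split3` was certified against a mock
render).  Pure logic — two excluded middles, on the inlined «residually absolutely reducible over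
some finite solvable Galois `L/K`» dial and on the inlined «potentially ordinary with regular labelled
weights» dial — written with `by_contra` so that neither dial is restated.  No definitions, no new
mathematics.
-/

set_option linter.dupNamespace false -- project-wide option; `Summit.Langlands.Langlands` is the mandated namespace

namespace Summit.Langlands.Langlands.Theorems

open Summit.Langlands.Langlands.Theses.ResidualAvatarLadder in
/-- The glue item `stmt-Langlands-31188` of route ResidualAvatarLadder (rev 4): the three children
`CoreIrreducibleAutomorphy` (C), `CoreReducibleOrdinaryAutomorphy` (R_ord) and
`CoreReducibleNonOrdinaryAutomorphy` (R_nonord) of the resplit of `ResiduallyLieAutomorphy` (S2) imply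
the parent.  Proof: if every residual representation of `ρ|Γ_L` over every finite solvable Galois
`L/K` is absolutely irreducible, C applies; otherwise a reducible witness `(L, σ)` exists and, by
excluded middle on potential ordinarity, R_ord or R_nonord applies. -/
theorem ResiduallyLieAutomorphy_of_split3_proof :
    Summit.Langlands.Langlands.Theses.ResidualAvatarLadder.ResiduallyLieAutomorphy_of_split3 := by
  intro hC hO hN K _ _ n hcpt hn ℓ _ ι ρ hirr hgeo htw hbox
  by_contra hno
  refine hno (hC K n hcpt hn ℓ ι ρ hirr hgeo htw ⟨hbox, fun L _ _ _ hgal hsolv σ hσ => ?_⟩)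
  by_contra hred
  refine hno (hN K n hcpt hn ℓ ι ρ hirr hgeo htw
    ⟨⟨hbox, L, inferInstance, inferInstance, inferInstance, hgal, hsolv, σ, hσ, hred⟩, fun ho => ?_⟩)
  exact hno (hO K n hcpt hn ℓ ι ρ hirr hgeo htw
    ⟨⟨hbox, L, inferInstance, inferInstance, inferInstance, hgal, hsolv, σ, hσ, hred⟩, ho⟩)

end Summit.Langlands.Langlands.Theorems
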